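import Literature.Combinatorics.SetFamily.SpreadApproximation
import HarnessLib

/-!
# The Kupavskii–Zakharov spread approximation lemma for WEIGHTS (measures with bounded density)

Source: A. Kupavskii, D. Zakharov, *Spread approximations for forbidden intersections problems*,
Adv. Math. 445 (2024) 109653 = arXiv:2203.13379 [KupavskiiZakharov2022]: §2 (relative
`τ`-homogeneity, Observation 8) and §3.1 (the spread approximation procedure, Lemma 11) — the SET
versions are `Literature.Combinatorics.SetFamily.SpreadApproximation` (this file's import, whose
vocabulary `supersets 𝒜 S = 𝒜(S)`, `link`, `IsRelHomogeneous`, `SpreadApproximation` we reuse).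

What is here (everything proved, no named facts): the VERBATIM TRANSCRIPTION of Observation 8 and Lemma 11
from a subfamily `ℱ ⊆ 𝒜` (i.e. the weight `1_ℱ`) to a WEIGHT `y : Finset α → ℝ` with `0 ≤ y ≤ 1` carried
by a subfamily `ℱ ⊆ 𝒜` — every cardinality `|ℱ(S)|` of the printed argument becomes the mass
`wmass y (ℱ(S)) = Σ_{A ∈ ℱ, S ⊆ A} y(A)`, the ambient counts `|𝒜(S)|` stay cardinalities:

* `wmass y P = Σ_{A ∈ P} y A` and its bookkeeping;
* `IsRelHomogeneousW τ 𝒜 y ℱ` — `(𝒜, τ)`-homogeneity of the weight `y|_ℱ`: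
  `wmass y (ℱ(S)) · |𝒜| ≤ τ^{|S|} · |𝒜(S)| · wmass y ℱ` for all `S`; for `y ≡ 1` this is literally
  `IsRelHomogeneous τ 𝒜 ℱ` (`isRelHomogeneousW_one_iff`);
* `isRelHomogeneousW_supersets_of_maximal` — KZ Observation 8 for weights (same proof);
* `WeightedSpreadApproximation 𝒜 ℱ y τ q`, `exists_weightedSpreadApproximation` — KZ Lemma 11 for
  weights, with the modified stopping rule of the set file: disjoint nonempty pieces `ℱ_i ⊆ ℱ(S_i)`,
  `|S_i| ≤ q`, `y|_{ℱ_i}` `(𝒜(S_i), τ)`-homogeneous, remainder mass `wmass y ℱ' · τ^{q+1} ≤ |𝒜|`, and the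
  accounting `|𝒜(S_i)| ≤ τ^{q+1} · wmass y ℱ_i`;
* the disjoint-from-the-core form (`isRelHomogeneousW_supersets_iff`) and the LINK form with the
  transported weight `B ↦ y(S ∪ B)` (`wmass_link`, `IsRelHomogeneousW.link`).

Why (declared): the `PneNP` matching-polytope programme (cell pnp-psdrank, route `ChebyshevTracialDesign`)
runs the `r = 1` rung with the set version (a family `Y` of perfect matchings); its psd rung replaces the
family by the weight `y(M) = tr(Y_M)/r ∈ [0,1]` of a family of psd contractions `0 ⪯ Y_M ⪯ I_r`
(MEMO-13 §3 (3) of that cell: "weighted KZ + the dichotomy with `y(M) = tr(Y_M)/r`: the S1 step of a psd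
rung"). The printed proofs use only additivity and monotonicity of `|·|` on subfamilies and `|ℱ(S)| ≤ |𝒜(S)|`,
which hold for `wmass y` under `0 ≤ y ≤ 1`; nothing else changes. [cite: KupavskiiZakharov2022, Observation 8 and Lemma 11]
-/

namespace Literature.Combinatorics.SetFamily

open Finset

variable {α : Type*} [DecidableEq α]

/-! ### Mass of a subfamily under a weight -/

/-- The **mass** of the subfamily `P` under the weight `y`: `Σ_{A ∈ P} y(A)` (for `y = 1_ℱ` and `P ⊆ ℱ`
this is `|P|`). [cite: KupavskiiZakharov2022, §2 (|ℱ(S)|, here for a weight)] -/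
def wmass (y : Finset α → ℝ) (P : Finset (Finset α)) : ℝ := ∑ A ∈ P, y A

omit [DecidableEq α] in
/-- Unfolding. [cite: KupavskiiZakharov2022, §2] -/
theorem wmass_def (y : Finset α → ℝ) (P : Finset (Finset α)) : wmass y P = ∑ A ∈ P, y A := rfl

omit [DecidableEq α] in
/-- `wmass y ∅ = 0`. [cite: KupavskiiZakharov2022, §2] -/
@[simp] theorem wmass_empty (y : Finset α → ℝ) : wmass y (∅ : Finset (Finset α)) = 0 := by
  simp [wmass]

omit [DecidableEq α] in
/-- Mass is nonnegative for a nonnegative weight. [cite: KupavskiiZakharov2022, §2] -/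
theorem wmass_nonneg {y : Finset α → ℝ} (hy : ∀ A, 0 ≤ y A) (P : Finset (Finset α)) : 0 ≤ wmass y P :=
  sum_nonneg fun A _ => hy A

omit [DecidableEq α] in
/-- Mass is monotone in the subfamily for a nonnegative weight. [cite: KupavskiiZakharov2022, §2] -/
theorem wmass_mono {y : Finset α → ℝ} (hy : ∀ A, 0 ≤ y A) {P Q : Finset (Finset α)} (h : P ⊆ Q) :
    wmass y P ≤ wmass y Q :=
  sum_le_sum_of_subset_of_nonneg h fun A _ _ => hy A

omit [DecidableEq α] in
/-- Mass is at most cardinality for a weight `≤ 1`. [cite: KupavskiiZakharov2022, §2] -/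
theorem wmass_le_card {y : Finset α → ℝ} (hy : ∀ A, y A ≤ 1) (P : Finset (Finset α)) :
    wmass y P ≤ #P := by
  calc wmass y P ≤ ∑ A ∈ P, (1 : ℝ) := sum_le_sum fun A _ => hy A
    _ = #P := by simp

/-- Mass is additive on disjoint unions. [cite: KupavskiiZakharov2022, §2] -/
theorem wmass_union {y : Finset α → ℝ} {P Q : Finset (Finset α)} (h : Disjoint P Q) :
    wmass y (P ∪ Q) = wmass y P + wmass y Q := by
  unfold wmass; exact sum_union h

/-- Mass of a difference: `wmass y (Q ∖ P) + wmass y P = wmass y Q` for `P ⊆ Q`. [cite: KupavskiiZakharov2022, §2] -/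
theorem wmass_sdiff_add {y : Finset α → ℝ} {P Q : Finset (Finset α)} (h : P ⊆ Q) :
    wmass y (Q \ P) + wmass y P = wmass y Q := by
  rw [← wmass_union sdiff_disjoint, sdiff_union_of_subset h]

/-- Mass of a disjoint indexed union. [cite: KupavskiiZakharov2022, §2] -/
theorem wmass_biUnion {y : Finset α → ℝ} {k : ℕ} (P : Fin k → Finset (Finset α))
    (h : ∀ i j, i ≠ j → Disjoint (P i) (P j)) : wmass y (univ.biUnion P) = ∑ i, wmass y (P i) := by
  unfold wmass; exact sum_biUnion fun i _ j _ hij => h i j hij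

omit [DecidableEq α] in
/-- For the constant weight `1` the mass is the cardinality. [cite: KupavskiiZakharov2022, §2] -/
@[simp] theorem wmass_one (P : Finset (Finset α)) : wmass (fun _ => (1 : ℝ)) P = #P := by
  simp [wmass]

omit [DecidableEq α] in
/-- A subfamily of zero mass under a nonnegative weight: every sub-subfamily has zero mass.
[cite: KupavskiiZakharov2022, §2] -/
theorem wmass_eq_zero_of_subset {y : Finset α → ℝ} (hy : ∀ A, 0 ≤ y A) {P Q : Finset (Finset α)}
    (h : P ⊆ Q) (hQ : wmass y Q = 0) : wmass y P = 0 :=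
  le_antisymm (hQ ▸ wmass_mono hy h) (wmass_nonneg hy P)

/-! ### Relative homogeneity of a weight (KZ §2, transcribed) -/

/-- **Relative `τ`-homogeneity of a weight.** The weight `y` carried by the subfamily `ℱ` is
`(𝒜, τ)`-homogeneous if `y(ℱ(S))/y(ℱ) ≤ τ^{|S|} |𝒜(S)|/|𝒜|` for every set `S`, stated division-free:
`wmass y (ℱ(S)) · |𝒜| ≤ τ^{|S|} · |𝒜(S)| · wmass y ℱ`. For `y ≡ 1` this is `IsRelHomogeneous τ 𝒜 ℱ`.
[cite: KupavskiiZakharov2022, §2 (definition of (𝒜, τ)-homogeneous, before Observation 8)] -/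
def IsRelHomogeneousW (τ : ℝ) (𝒜 : Finset (Finset α)) (y : Finset α → ℝ) (ℱ : Finset (Finset α)) : Prop :=
  ∀ S : Finset α, wmass y (supersets ℱ S) * #𝒜 ≤ τ ^ #S * #(supersets 𝒜 S) * wmass y ℱ

/-- The weighted notion at the constant weight `1` is the set notion. [cite: KupavskiiZakharov2022, §2] -/
theorem isRelHomogeneousW_one_iff {τ : ℝ} {𝒜 ℱ : Finset (Finset α)} :
    IsRelHomogeneousW τ 𝒜 (fun _ => (1 : ℝ)) ℱ ↔ IsRelHomogeneous τ 𝒜 ℱ := by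
  simp only [IsRelHomogeneousW, IsRelHomogeneous, wmass_one]

/-- The printed ratio form for a nonempty ambient family and positive mass.
[cite: KupavskiiZakharov2022, §2 (definition of (𝒜, τ)-homogeneous)] -/
theorem isRelHomogeneousW_iff {τ : ℝ} {𝒜 ℱ : Finset (Finset α)} {y : Finset α → ℝ} (h𝒜 : 𝒜.Nonempty)
    (hℱ : 0 < wmass y ℱ) :
    IsRelHomogeneousW τ 𝒜 y ℱ ↔
      ∀ S : Finset α, wmass y (supersets ℱ S) / wmass y ℱ ≤ τ ^ #S * (#(supersets 𝒜 S) / #𝒜) := by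
  have hA : (0 : ℝ) < #𝒜 := by exact_mod_cast h𝒜.card_pos
  refine forall_congr' fun S => ?_
  rw [div_le_iff₀ hℱ, show τ ^ #S * (#(supersets 𝒜 S) / #𝒜) * wmass y ℱ
      = τ ^ #S * #(supersets 𝒜 S) * wmass y ℱ / #𝒜 by ring, le_div_iff₀ hA]

/-- The empty subfamily carries a homogeneous weight. [cite: KupavskiiZakharov2022, §2] -/
theorem isRelHomogeneousW_empty (τ : ℝ) (𝒜 : Finset (Finset α)) (y : Finset α → ℝ) :
    IsRelHomogeneousW τ 𝒜 y ∅ := by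
  intro S
  simp only [supersets_emptyFamily, wmass_empty, zero_mul, mul_zero, le_refl]

/-- Monotonicity in the parameter (`0 ≤ τ ≤ τ'`, nonnegative weight). [cite: KupavskiiZakharov2022, §2] -/
theorem IsRelHomogeneousW.mono {τ τ' : ℝ} (hτ : 0 ≤ τ) (hle : τ ≤ τ') {𝒜 ℱ : Finset (Finset α)}
    {y : Finset α → ℝ} (hy : ∀ A, 0 ≤ y A) (h : IsRelHomogeneousW τ 𝒜 y ℱ) :
    IsRelHomogeneousW τ' 𝒜 y ℱ := fun S =>
  (h S).trans <|
    mul_le_mul_of_nonneg_right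
      (mul_le_mul_of_nonneg_right (pow_le_pow_left₀ hτ hle _) (Nat.cast_nonneg _)) (wmass_nonneg hy _)

/-- The printed consequence for a nonempty ambient family: `y(ℱ(S)) ≤ τ^{|S|} (|𝒜(S)|/|𝒜|) y(ℱ)`.
[cite: KupavskiiZakharov2022, §2] -/
theorem IsRelHomogeneousW.wmass_supersets_le {τ : ℝ} {𝒜 ℱ : Finset (Finset α)} {y : Finset α → ℝ}
    (h : IsRelHomogeneousW τ 𝒜 y ℱ) (h𝒜 : 𝒜.Nonempty) (S : Finset α) :
    wmass y (supersets ℱ S) ≤ τ ^ #S * (#(supersets 𝒜 S) / #𝒜) * wmass y ℱ := by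
  have hA : (0 : ℝ) < #𝒜 := by exact_mod_cast h𝒜.card_pos
  rw [show τ ^ #S * (#(supersets 𝒜 S) / #𝒜) * wmass y ℱ = τ ^ #S * #(supersets 𝒜 S) * wmass y ℱ / #𝒜 by ring,
    le_div_iff₀ hA]
  exact h S

/-! ### KZ Observation 8 for weights: the maximal dense set gives a homogeneous piece -/

/-- **KZ Observation 8, weighted.** Let `ℱ ⊆ 𝒜` carry a nonnegative weight `y`, `τ ≥ 1`, and let `X`
satisfy the density inequality `y(ℱ(X)) ≥ τ^{|X|} (|𝒜(X)|/|𝒜|) y(ℱ)` and be inclusion-maximal with this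
property among the sets contained in some member of `ℱ`. Then `y|_{ℱ(X)}` is `(𝒜(X), τ)`-homogeneous.
(Printed proof, verbatim with `|·| ↦ y(·)` on the `ℱ`-side: for `B = X ∪ S ⊋ X`,
`y(ℱ(B)) < τ^{|B|} (|𝒜(B)|/|𝒜|) y(ℱ) ≤ τ^{|B|-|X|} (|𝒜(B)|/|𝒜(X)|) y(ℱ(X))`.)
[cite: KupavskiiZakharov2022, Observation 8] -/
theorem isRelHomogeneousW_supersets_of_maximal {τ : ℝ} (hτ : 1 ≤ τ) {𝒜 ℱ : Finset (Finset α)}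
    {y : Finset α → ℝ} (hy : ∀ A, 0 ≤ y A) (hℱ : ℱ ⊆ 𝒜) {X : Finset α}
    (hX : τ ^ #X * #(supersets 𝒜 X) * wmass y ℱ ≤ wmass y (supersets ℱ X) * #𝒜)
    (hmax : ∀ B : Finset α, X ⊂ B → (supersets ℱ B).Nonempty →
      wmass y (supersets ℱ B) * #𝒜 < τ ^ #B * #(supersets 𝒜 B) * wmass y ℱ) :
    IsRelHomogeneousW τ (supersets 𝒜 X) y (supersets ℱ X) := by
  have hτ0 : 0 ≤ τ := zero_le_one.trans hτ
  intro S
  rw [supersets_supersets, supersets_supersets]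
  have hFX0 : 0 ≤ wmass y (supersets ℱ X) := wmass_nonneg hy _
  by_cases hSX : S ⊆ X
  · rw [union_eq_left.2 hSX]
    calc wmass y (supersets ℱ X) * #(supersets 𝒜 X)
          = 1 * #(supersets 𝒜 X) * wmass y (supersets ℱ X) := by ring
      _ ≤ τ ^ #S * #(supersets 𝒜 X) * wmass y (supersets ℱ X) :=
        mul_le_mul_of_nonneg_right
          (mul_le_mul_of_nonneg_right (one_le_pow₀ hτ) (Nat.cast_nonneg _)) hFX0
  have hXB : X ⊂ X ∪ S :=
    Finset.ssubset_iff_subset_ne.2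
      ⟨subset_union_left, fun h => hSX (by rw [h]; exact subset_union_right)⟩
  have hRHS0 : 0 ≤ τ ^ #S * #(supersets 𝒜 (X ∪ S)) * wmass y (supersets ℱ X) :=
    mul_nonneg (mul_nonneg (pow_nonneg hτ0 _) (Nat.cast_nonneg _)) hFX0
  rcases (supersets ℱ (X ∪ S)).eq_empty_or_nonempty with hB0 | hBne
  · rw [hB0, wmass_empty, zero_mul]
    exact hRHS0
  -- if `ℱ` has zero mass, everything vanishes
  by_cases hF0 : wmass y ℱ = 0
  · have h1 : wmass y (supersets ℱ (X ∪ S)) = 0 := wmass_eq_zero_of_subset hy (supersets_subset _ _) hF0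
    rw [h1, zero_mul]
    exact hRHS0
  have hℱpos : 0 < wmass y ℱ := lt_of_le_of_ne (wmass_nonneg hy _) (Ne.symm hF0)
  have h1 := (hmax _ hXB hBne).le
  have h𝒜pos : (0 : ℝ) < #𝒜 := by
    exact_mod_cast (hBne.mono ((supersets_subset _ _).trans hℱ)).card_pos
  have hτX : (0 : ℝ) < τ ^ #X := pow_pos (zero_lt_one.trans_le hτ) _
  have h3 : τ ^ #(X ∪ S) ≤ τ ^ #X * τ ^ #S := by
    rw [← pow_add]; exact pow_le_pow_right₀ hτ (card_union_le X S)
  refine le_of_mul_le_mul_right ?_ (mul_pos (mul_pos h𝒜pos hℱpos) hτX)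
  calc wmass y (supersets ℱ (X ∪ S)) * #(supersets 𝒜 X) * (#𝒜 * wmass y ℱ * τ ^ #X)
        = (wmass y (supersets ℱ (X ∪ S)) * #𝒜) * (τ ^ #X * #(supersets 𝒜 X) * wmass y ℱ) := by ring
    _ ≤ (τ ^ #(X ∪ S) * #(supersets 𝒜 (X ∪ S)) * wmass y ℱ) * (wmass y (supersets ℱ X) * #𝒜) :=
        mul_le_mul h1 hX (mul_nonneg (mul_nonneg hτX.le (Nat.cast_nonneg _)) (wmass_nonneg hy _))
          (mul_nonneg (mul_nonneg (pow_nonneg hτ0 _) (Nat.cast_nonneg _)) (wmass_nonneg hy _))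
    _ = τ ^ #(X ∪ S) * (#(supersets 𝒜 (X ∪ S)) * wmass y ℱ * wmass y (supersets ℱ X) * #𝒜) := by ring
    _ ≤ (τ ^ #X * τ ^ #S) * (#(supersets 𝒜 (X ∪ S)) * wmass y ℱ * wmass y (supersets ℱ X) * #𝒜) :=
        mul_le_mul_of_nonneg_right h3
          (mul_nonneg (mul_nonneg (mul_nonneg (Nat.cast_nonneg _) (wmass_nonneg hy _)) hFX0)
            (Nat.cast_nonneg _))
    _ = τ ^ #S * #(supersets 𝒜 (X ∪ S)) * wmass y (supersets ℱ X) * (#𝒜 * wmass y ℱ * τ ^ #X) := by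
        ring

/-- **The greedy step, weighted.** For a nonempty `ℱ` there is a set `X`, contained in some member of
`ℱ`, satisfying `y(ℱ(X)) ≥ τ^{|X|} (|𝒜(X)|/|𝒜|) y(ℱ)` and inclusion-maximal with this property among sets
contained in a member of `ℱ` (`X = ∅` qualifies). [cite: KupavskiiZakharov2022, §3.1 (procedure after Lemma 11)] -/
theorem exists_maximal_denseW (τ : ℝ) (𝒜 : Finset (Finset α)) (y : Finset α → ℝ) {ℱ : Finset (Finset α)}
    (hℱ : ℱ.Nonempty) :
    ∃ X : Finset α, ((supersets ℱ X).Nonempty ∧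
        τ ^ #X * #(supersets 𝒜 X) * wmass y ℱ ≤ wmass y (supersets ℱ X) * #𝒜) ∧
      ∀ B : Finset α, X ⊂ B → (supersets ℱ B).Nonempty →
        wmass y (supersets ℱ B) * #𝒜 < τ ^ #B * #(supersets 𝒜 B) * wmass y ℱ := by
  classical
  let Q : Finset (Finset α) := (ℱ.sup id).powerset.filter fun X =>
    (supersets ℱ X).Nonempty ∧ τ ^ #X * #(supersets 𝒜 X) * wmass y ℱ ≤ wmass y (supersets ℱ X) * #𝒜
  have h0 : ∅ ∈ Q := by
    refine mem_filter.2 ⟨empty_mem_powerset _, ?_, ?_⟩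
    · rwa [supersets_emptyset]
    · rw [supersets_emptyset, supersets_emptyset, card_empty, pow_zero, one_mul, mul_comm]
  obtain ⟨X, hX⟩ := Q.exists_maximal ⟨∅, h0⟩
  refine ⟨X, (mem_filter.1 hX.1).2, fun B hXB hBne => ?_⟩
  by_contra hlt
  have hBQ : B ∈ Q :=
    mem_filter.2 ⟨mem_powerset.2 (subset_sup_of_supersets_nonempty hBne), hBne, not_lt.1 hlt⟩
  exact hXB.2 (hX.2 hBQ hXB.1)

/-! ### KZ Lemma 11 for weights: weighted spread approximations -/

/-- A **weighted spread approximation** of the weight `y` carried by `ℱ ⊆ 𝒜`, parameters `τ, q`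
(KZ Lemma 11 with `|·| ↦ y(·)` on the `ℱ`-side, and the modified stopping rule of the set file):
pieces `ℱ_i ⊆ ℱ(S_i)` with cores `|S_i| ≤ q`, pairwise disjoint and nonempty, `y|_{ℱ_i}` being
`(𝒜(S_i), τ)`-homogeneous; the remainder `ℱ' = ℱ ∖ ⋃_i ℱ_i` has `y(ℱ') · τ^{q+1} ≤ |𝒜|`; and each piece
pays for its core: `|𝒜(S_i)| ≤ τ^{q+1} y(ℱ_i)`. [cite: KupavskiiZakharov2022, Lemma 11] -/
structure WeightedSpreadApproximation (𝒜 ℱ : Finset (Finset α)) (y : Finset α → ℝ) (τ : ℝ) (q : ℕ) where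
  /-- the number of pieces -/
  k : ℕ
  /-- the cores `S_i` -/
  core : Fin k → Finset α
  /-- the pieces `ℱ_i` -/
  piece : Fin k → Finset (Finset α)
  /-- `|S_i| ≤ q` -/
  card_core_le : ∀ i, #(core i) ≤ q
  /-- every piece is nonempty -/
  piece_nonempty : ∀ i, (piece i).Nonempty
  /-- `ℱ_i ⊆ ℱ(S_i)` -/
  piece_subset : ∀ i, piece i ⊆ supersets ℱ (core i)
  /-- the pieces are pairwise disjoint -/
  disjoint : ∀ i j, i ≠ j → Disjoint (piece i) (piece j)
  /-- KZ (ii), weighted: `y|_{ℱ_i}` is `(𝒜(S_i), τ)`-homogeneous -/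
  homogeneous : ∀ i, IsRelHomogeneousW τ (supersets 𝒜 (core i)) y (piece i)
  /-- KZ (iii), weighted: the remainder has `y(ℱ') τ^{q+1} ≤ |𝒜|` -/
  wmass_remainder_le : wmass y (ℱ \ univ.biUnion piece) * τ ^ (q + 1) ≤ #𝒜
  /-- accounting of the modified stopping rule: `|𝒜(S_i)| ≤ τ^{q+1} y(ℱ_i)` -/
  card_supersets_le : ∀ i, (#(supersets 𝒜 (core i)) : ℝ) ≤ τ ^ (q + 1) * wmass y (piece i)

namespace WeightedSpreadApproximation

variable {𝒜 ℱ : Finset (Finset α)} {y : Finset α → ℝ} {τ : ℝ} {q : ℕ}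

/-- The remainder `ℱ' = ℱ ∖ ⋃_i ℱ_i`. [cite: KupavskiiZakharov2022, Lemma 11] -/
def remainder (D : WeightedSpreadApproximation 𝒜 ℱ y τ q) : Finset (Finset α) :=
  ℱ \ univ.biUnion D.piece

/-- Membership in the remainder. [cite: KupavskiiZakharov2022, Lemma 11] -/
theorem mem_remainder (D : WeightedSpreadApproximation 𝒜 ℱ y τ q) {A : Finset α} :
    A ∈ D.remainder ↔ A ∈ ℱ ∧ ∀ i, A ∉ D.piece i := by
  simp only [remainder, mem_sdiff, mem_biUnion, mem_univ, true_and, not_exists]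

/-- `ℱ' ⊆ ℱ`. [cite: KupavskiiZakharov2022, Lemma 11] -/
theorem remainder_subset (D : WeightedSpreadApproximation 𝒜 ℱ y τ q) : D.remainder ⊆ ℱ := sdiff_subset

/-- `ℱ_i ⊆ ℱ`. [cite: KupavskiiZakharov2022, Lemma 11] -/
theorem piece_subset_family (D : WeightedSpreadApproximation 𝒜 ℱ y τ q) (i : Fin D.k) : D.piece i ⊆ ℱ :=
  (D.piece_subset i).trans (supersets_subset _ _)

/-- Members of `ℱ_i` contain the core `S_i`. [cite: KupavskiiZakharov2022, Lemma 11] -/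
theorem core_subset_of_mem_piece (D : WeightedSpreadApproximation 𝒜 ℱ y τ q) {i : Fin D.k}
    {A : Finset α} (h : A ∈ D.piece i) : D.core i ⊆ A :=
  (mem_supersets.1 (D.piece_subset i h)).2

/-- `ℱ_i ⊆ 𝒜(S_i)` when `ℱ ⊆ 𝒜`. [cite: KupavskiiZakharov2022, Lemma 11] -/
theorem piece_subset_supersets (D : WeightedSpreadApproximation 𝒜 ℱ y τ q) (hℱ : ℱ ⊆ 𝒜) (i : Fin D.k) :
    D.piece i ⊆ supersets 𝒜 (D.core i) :=
  (D.piece_subset i).trans (supersets_mono hℱ _)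

/-- `⋃_i ℱ_i ⊆ ℱ`. [cite: KupavskiiZakharov2022, Lemma 11] -/
theorem biUnion_piece_subset (D : WeightedSpreadApproximation 𝒜 ℱ y τ q) : univ.biUnion D.piece ⊆ ℱ :=
  biUnion_subset.2 fun i _ => D.piece_subset_family i

/-- The decomposition `ℱ = ℱ' ∪ ⋃_i ℱ_i`. [cite: KupavskiiZakharov2022, Lemma 11] -/
theorem remainder_union_biUnion (D : WeightedSpreadApproximation 𝒜 ℱ y τ q) :
    D.remainder ∪ univ.biUnion D.piece = ℱ :=
  sdiff_union_of_subset D.biUnion_piece_subset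

/-- `ℱ'` is disjoint from every piece. [cite: KupavskiiZakharov2022, Lemma 11] -/
theorem disjoint_remainder_piece (D : WeightedSpreadApproximation 𝒜 ℱ y τ q) (i : Fin D.k) :
    Disjoint D.remainder (D.piece i) :=
  disjoint_sdiff_self_left.mono_right (subset_biUnion_of_mem D.piece (mem_univ i))

/-- **KZ Lemma 11 (i)**: every member of `ℱ` outside the remainder lies in a piece and contains its core.
[cite: KupavskiiZakharov2022, Lemma 11 (i)] -/
theorem exists_core_subset (D : WeightedSpreadApproximation 𝒜 ℱ y τ q) {A : Finset α} (hA : A ∈ ℱ)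
    (hA' : A ∉ D.remainder) : ∃ i, A ∈ D.piece i ∧ D.core i ⊆ A := by
  rw [mem_remainder, not_and, not_forall] at hA'
  obtain ⟨i, hi⟩ := hA' hA
  rw [not_not] at hi
  exact ⟨i, hi, D.core_subset_of_mem_piece hi⟩

/-- `y(⋃_i ℱ_i) = Σ_i y(ℱ_i)`. [cite: KupavskiiZakharov2022, Lemma 11] -/
theorem wmass_biUnion_piece (D : WeightedSpreadApproximation 𝒜 ℱ y τ q) :
    wmass y (univ.biUnion D.piece) = ∑ i, wmass y (D.piece i) :=
  wmass_biUnion D.piece D.disjoint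

/-- `y(ℱ') + Σ_i y(ℱ_i) = y(ℱ)`. [cite: KupavskiiZakharov2022, Lemma 11] -/
theorem wmass_remainder_add_sum (D : WeightedSpreadApproximation 𝒜 ℱ y τ q) :
    wmass y D.remainder + ∑ i, wmass y (D.piece i) = wmass y ℱ := by
  rw [← wmass_biUnion_piece, remainder, wmass_sdiff_add D.biUnion_piece_subset]

/-- `Σ_i y(ℱ_i) ≤ y(ℱ)` for a nonnegative weight. [cite: KupavskiiZakharov2022, Lemma 11] -/
theorem sum_wmass_piece_le (D : WeightedSpreadApproximation 𝒜 ℱ y τ q) (hy : ∀ A, 0 ≤ y A) :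
    ∑ i, wmass y (D.piece i) ≤ wmass y ℱ := by
  rw [← wmass_biUnion_piece]
  exact wmass_mono hy D.biUnion_piece_subset

/-- **KZ Lemma 11 (iii), weighted**, printed form `y(ℱ') ≤ τ^{-q-1} |𝒜|`. [cite: KupavskiiZakharov2022, Lemma 11 (iii)] -/
theorem wmass_remainder_le' (D : WeightedSpreadApproximation 𝒜 ℱ y τ q) (hτ : 0 < τ) :
    wmass y D.remainder ≤ #𝒜 / τ ^ (q + 1) := by
  rw [le_div_iff₀ (pow_pos hτ _)]
  exact D.wmass_remainder_le

/-- The accounting summed: `Σ_i |𝒜(S_i)| ≤ τ^{q+1} y(ℱ)` (nonnegative weight).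
[cite: KupavskiiZakharov2022, Lemma 11 (procedure)] -/
theorem sum_card_supersets_le (D : WeightedSpreadApproximation 𝒜 ℱ y τ q) (hτ : 0 ≤ τ)
    (hy : ∀ A, 0 ≤ y A) : ∑ i, (#(supersets 𝒜 (D.core i)) : ℝ) ≤ τ ^ (q + 1) * wmass y ℱ := by
  calc ∑ i, (#(supersets 𝒜 (D.core i)) : ℝ) ≤ ∑ i, τ ^ (q + 1) * wmass y (D.piece i) :=
        sum_le_sum fun i _ => D.card_supersets_le i
    _ = τ ^ (q + 1) * ∑ i, wmass y (D.piece i) := by rw [← mul_sum]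
    _ ≤ τ ^ (q + 1) * wmass y ℱ := mul_le_mul_of_nonneg_left (D.sum_wmass_piece_le hy) (pow_nonneg hτ _)

/-- Normalised form `y(ℱ')/|𝒜| ≤ τ^{-(q+1)}`. [cite: KupavskiiZakharov2022, Lemma 11 (iii)] -/
theorem wmass_remainder_div_le (D : WeightedSpreadApproximation 𝒜 ℱ y τ q) (hτ : 0 < τ)
    (h𝒜 : 𝒜.Nonempty) : wmass y D.remainder / #𝒜 ≤ (τ ^ (q + 1))⁻¹ := by
  have hA : (0 : ℝ) < #𝒜 := by exact_mod_cast h𝒜.card_pos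
  rw [div_le_iff₀ hA, inv_mul_eq_div]
  exact D.wmass_remainder_le' hτ

/-- Normalised accounting `Σ_i |𝒜(S_i)|/|𝒜| ≤ τ^{q+1} y(ℱ)/|𝒜|`. [cite: KupavskiiZakharov2022, Lemma 11 (procedure)] -/
theorem sum_card_supersets_div_le (D : WeightedSpreadApproximation 𝒜 ℱ y τ q) (hτ : 0 ≤ τ)
    (hy : ∀ A, 0 ≤ y A) (h𝒜 : 𝒜.Nonempty) :
    ∑ i, (#(supersets 𝒜 (D.core i)) : ℝ) / #𝒜 ≤ τ ^ (q + 1) * (wmass y ℱ / #𝒜) := by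
  have hA : (0 : ℝ) < #𝒜 := by exact_mod_cast h𝒜.card_pos
  rw [← sum_div, div_le_iff₀ hA, mul_assoc, div_mul_cancel₀ _ hA.ne']
  exact D.sum_card_supersets_le hτ hy

/-- The trivial approximation (no pieces), admissible when `y(ℱ) τ^{q+1} ≤ |𝒜|`.
[cite: KupavskiiZakharov2022, Lemma 11 (procedure, stopping step)] -/
def nil (h : wmass y ℱ * τ ^ (q + 1) ≤ #𝒜) : WeightedSpreadApproximation 𝒜 ℱ y τ q where
  k := 0
  core := fun i => i.elim0
  piece := fun i => i.elim0
  card_core_le := fun i => i.elim0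
  piece_nonempty := fun i => i.elim0
  piece_subset := fun i => i.elim0
  disjoint := fun i => i.elim0
  homogeneous := fun i => i.elim0
  wmass_remainder_le := by simpa using h
  card_supersets_le := fun i => i.elim0

/-- One step of the procedure: prepend a piece `P` with core `X` to an approximation of `ℱ ∖ P`.
[cite: KupavskiiZakharov2022, Lemma 11 (procedure, iteration step)] -/
def cons (X : Finset α) (P : Finset (Finset α)) (D : WeightedSpreadApproximation 𝒜 (ℱ \ P) y τ q)
    (hXq : #X ≤ q) (hPne : P.Nonempty) (hP : P ⊆ supersets ℱ X)
    (hhom : IsRelHomogeneousW τ (supersets 𝒜 X) y P)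
    (hacc : (#(supersets 𝒜 X) : ℝ) ≤ τ ^ (q + 1) * wmass y P) : WeightedSpreadApproximation 𝒜 ℱ y τ q where
  k := D.k + 1
  core := Fin.cons X D.core
  piece := Fin.cons P D.piece
  card_core_le i := by
    rcases Fin.eq_zero_or_eq_succ i with rfl | ⟨j, rfl⟩
    · simpa using hXq
    · simpa using D.card_core_le j
  piece_nonempty i := by
    rcases Fin.eq_zero_or_eq_succ i with rfl | ⟨j, rfl⟩
    · simpa using hPne
    · simpa using D.piece_nonempty j
  piece_subset i := by
    rcases Fin.eq_zero_or_eq_succ i with rfl | ⟨j, rfl⟩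
    · simpa using hP
    · simpa using (D.piece_subset j).trans (supersets_mono sdiff_subset _)
  disjoint i j hij := by
    rcases Fin.eq_zero_or_eq_succ i with rfl | ⟨i, rfl⟩ <;>
      rcases Fin.eq_zero_or_eq_succ j with rfl | ⟨j, rfl⟩
    · exact absurd rfl hij
    · simpa using disjoint_sdiff.mono_right (D.piece_subset_family j)
    · simpa using (disjoint_sdiff.mono_right (D.piece_subset_family i)).symm
    · simpa using D.disjoint i j fun h => hij (by rw [h])
  homogeneous i := by
    rcases Fin.eq_zero_or_eq_succ i with rfl | ⟨j, rfl⟩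
    · simpa using hhom
    · simpa using D.homogeneous j
  wmass_remainder_le := by
    have h : ℱ \ (P ∪ univ.biUnion D.piece) = (ℱ \ P) \ univ.biUnion D.piece := by
      ext A
      simp only [mem_sdiff, mem_union, not_or, and_assoc]
    rw [SpreadApproximation.biUnion_univ_cons, h]
    exact D.wmass_remainder_le
  card_supersets_le i := by
    rcases Fin.eq_zero_or_eq_succ i with rfl | ⟨j, rfl⟩
    · simpa using hacc
    · simpa using D.card_supersets_le j

end WeightedSpreadApproximation

/-- The induction behind the weighted Lemma 11 (on the size of the supporting family `ℱ`).
[cite: KupavskiiZakharov2022, Lemma 11] -/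
private theorem exists_weightedSpreadApproximation_aux {𝒜 : Finset (Finset α)} {y : Finset α → ℝ}
    (hy0 : ∀ A, 0 ≤ y A) (hy1 : ∀ A, y A ≤ 1) {τ : ℝ} (hτ : 1 ≤ τ) (q : ℕ) :
    ∀ (n : ℕ) (ℱ : Finset (Finset α)), ℱ ⊆ 𝒜 → #ℱ ≤ n →
      Nonempty (WeightedSpreadApproximation 𝒜 ℱ y τ q) := by
  have hτ0 : 0 < τ := zero_lt_one.trans_le hτ
  intro n
  induction n with
  | zero =>
    intro ℱ _ hcard
    obtain rfl : ℱ = ∅ := card_eq_zero.1 (Nat.le_zero.1 hcard)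
    exact ⟨WeightedSpreadApproximation.nil (by simp)⟩
  | succ n ih =>
    intro ℱ hℱ hcard
    by_cases hsmall : wmass y ℱ * τ ^ (q + 1) ≤ #𝒜
    · exact ⟨WeightedSpreadApproximation.nil hsmall⟩
    have hbig : (#𝒜 : ℝ) < wmass y ℱ * τ ^ (q + 1) := lt_of_not_ge hsmall
    have hℱpos : 0 < wmass y ℱ := by
      by_contra hle
      have h0 : wmass y ℱ = 0 := le_antisymm (not_lt.1 hle) (wmass_nonneg hy0 _)
      rw [h0, zero_mul] at hbig
      exact absurd hbig (not_lt.2 (Nat.cast_nonneg _))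
    have hℱne : ℱ.Nonempty := by
      rw [nonempty_iff_ne_empty]
      rintro rfl
      rw [wmass_empty] at hℱpos
      exact lt_irrefl _ hℱpos
    obtain ⟨X, ⟨hXne, hXdense⟩, hXmax⟩ := exists_maximal_denseW τ 𝒜 y hℱne
    have hhom := isRelHomogeneousW_supersets_of_maximal hτ hy0 hℱ hXdense hXmax
    have hPpos : (0 : ℝ) < #(supersets ℱ X) := by exact_mod_cast hXne.card_pos
    have hP𝒜 : (#(supersets ℱ X) : ℝ) ≤ #(supersets 𝒜 X) := by
      exact_mod_cast card_le_card (supersets_mono hℱ X)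
    have h𝒜Xpos : (0 : ℝ) < #(supersets 𝒜 X) := hPpos.trans_le hP𝒜
    have hmassP : wmass y (supersets ℱ X) ≤ #(supersets 𝒜 X) :=
      (wmass_le_card hy1 _).trans hP𝒜
    by_cases hXq : q < #X
    · -- stop: `|S| > q`, remainder `ℱ`
      refine ⟨WeightedSpreadApproximation.nil (le_of_mul_le_mul_right ?_ h𝒜Xpos)⟩
      calc wmass y ℱ * τ ^ (q + 1) * #(supersets 𝒜 X)
            ≤ wmass y ℱ * τ ^ #X * #(supersets 𝒜 X) :=
          mul_le_mul_of_nonneg_right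
            (mul_le_mul_of_nonneg_left (pow_le_pow_right₀ hτ hXq) hℱpos.le) (Nat.cast_nonneg _)
        _ = τ ^ #X * #(supersets 𝒜 X) * wmass y ℱ := by ring
        _ ≤ wmass y (supersets ℱ X) * #𝒜 := hXdense
        _ ≤ #(supersets 𝒜 X) * #𝒜 := mul_le_mul_of_nonneg_right hmassP (Nat.cast_nonneg _)
        _ = #𝒜 * #(supersets 𝒜 X) := mul_comm _ _
    · -- iterate on `ℱ ∖ ℱ(X)`
      have hXq : #X ≤ q := not_lt.1 hXq
      have hlt : #(ℱ \ supersets ℱ X) < #ℱ :=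
        card_lt_card (sdiff_ssubset (supersets_subset ℱ X) hXne)
      obtain ⟨D⟩ := ih (ℱ \ supersets ℱ X) (sdiff_subset.trans hℱ) (by omega)
      refine ⟨D.cons X (supersets ℱ X) hXq hXne Subset.rfl hhom
        (le_of_mul_le_mul_right ?_ hℱpos)⟩
      calc (#(supersets 𝒜 X) : ℝ) * wmass y ℱ = 1 * #(supersets 𝒜 X) * wmass y ℱ := by ring
        _ ≤ τ ^ #X * #(supersets 𝒜 X) * wmass y ℱ :=
          mul_le_mul_of_nonneg_right
            (mul_le_mul_of_nonneg_right (one_le_pow₀ hτ) (Nat.cast_nonneg _)) hℱpos.le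
        _ ≤ wmass y (supersets ℱ X) * #𝒜 := hXdense
        _ ≤ wmass y (supersets ℱ X) * (wmass y ℱ * τ ^ (q + 1)) :=
          mul_le_mul_of_nonneg_left hbig.le (wmass_nonneg hy0 _)
        _ = τ ^ (q + 1) * wmass y (supersets ℱ X) * wmass y ℱ := by ring

/-- **Kupavskii–Zakharov Lemma 11 for weights (weighted spread approximation).** Fix an ambient family
`𝒜`, a weight `y` with `0 ≤ y ≤ 1`, `τ ≥ 1` and `q`. Every `ℱ ⊆ 𝒜` has a weighted spread approximation:
cores `S_1, …, S_k` of size `≤ q` and pairwise disjoint nonempty pieces `ℱ_i ⊆ ℱ(S_i)` such that (i) every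
member of `ℱ` outside the remainder `ℱ' = ℱ ∖ ⋃ ℱ_i` contains a core, (ii) `y|_{ℱ_i}` is
`(𝒜(S_i), τ)`-homogeneous, (iii) `y(ℱ') ≤ τ^{-q-1} |𝒜|`; moreover `|𝒜(S_i)| ≤ τ^{q+1} y(ℱ_i)`.
(Verbatim the printed procedure with `|·| ↦ y(·)` on the `ℱ`-side; `y ≤ 1` enters only through
`y(ℱ(X)) ≤ |𝒜(X)|` in the stopping step `|X| > q`.) [cite: KupavskiiZakharov2022, Lemma 11] -/
theorem exists_weightedSpreadApproximation {𝒜 ℱ : Finset (Finset α)} (hℱ : ℱ ⊆ 𝒜) {y : Finset α → ℝ}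
    (hy0 : ∀ A, 0 ≤ y A) (hy1 : ∀ A, y A ≤ 1) {τ : ℝ} (hτ : 1 ≤ τ) (q : ℕ) :
    Nonempty (WeightedSpreadApproximation 𝒜 ℱ y τ q) :=
  exists_weightedSpreadApproximation_aux hy0 hy1 hτ q _ ℱ hℱ le_rfl

/-- A chosen weighted spread approximation (by choice). [cite: KupavskiiZakharov2022, Lemma 11] -/
noncomputable def weightedSpreadApproximation {𝒜 ℱ : Finset (Finset α)} (hℱ : ℱ ⊆ 𝒜)
    {y : Finset α → ℝ} (hy0 : ∀ A, 0 ≤ y A) (hy1 : ∀ A, y A ≤ 1) {τ : ℝ} (hτ : 1 ≤ τ) (q : ℕ) :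
    WeightedSpreadApproximation 𝒜 ℱ y τ q :=
  Classical.choice (exists_weightedSpreadApproximation hℱ hy0 hy1 hτ q)

/-! ### Homogeneity relative to a star: the disjoint-from-the-core form, and the link form -/

/-- **Relative homogeneity of a weight with respect to a star is a condition on sets disjoint from the
core**: if every member of `ℱ` contains `S` and `τ ≥ 1`, then `y|_ℱ` is `(𝒜(S), τ)`-homogeneous iff
`y(ℱ(T)) · |𝒜(S)| ≤ τ^{|T|} · |𝒜(S ∪ T)| · y(ℱ)` for all `T` disjoint from `S` (nonnegative weight).
[cite: KupavskiiZakharov2022, Lemma 11 (ii) and §2 (definition)] -/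
theorem isRelHomogeneousW_supersets_iff {τ : ℝ} (hτ : 1 ≤ τ) {𝒜 ℱ : Finset (Finset α)}
    {y : Finset α → ℝ} (hy : ∀ A, 0 ≤ y A) {S : Finset α} (hℱ : ∀ A ∈ ℱ, S ⊆ A) :
    IsRelHomogeneousW τ (supersets 𝒜 S) y ℱ ↔
      ∀ T : Finset α, Disjoint S T →
        wmass y (supersets ℱ T) * #(supersets 𝒜 S) ≤ τ ^ #T * #(supersets 𝒜 (S ∪ T)) * wmass y ℱ := by
  constructor
  · intro h T _
    simpa only [supersets_supersets] using h T
  · intro h T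
    rw [supersets_supersets, supersets_eq_supersets_sdiff hℱ T, ← union_sdiff_self_eq_union]
    refine (h (T \ S) disjoint_sdiff).trans ?_
    exact mul_le_mul_of_nonneg_right
      (mul_le_mul_of_nonneg_right (pow_le_pow_right₀ hτ (card_le_card sdiff_subset))
        (Nat.cast_nonneg _)) (wmass_nonneg hy _)

/-- The pieces of a weighted spread approximation in the disjoint-from-the-core form.
[cite: KupavskiiZakharov2022, Lemma 11 (ii)] -/
theorem WeightedSpreadApproximation.homogeneous_disjoint {𝒜 ℱ : Finset (Finset α)} {y : Finset α → ℝ}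
    {τ : ℝ} {q : ℕ} (D : WeightedSpreadApproximation 𝒜 ℱ y τ q) (hτ : 1 ≤ τ) (hy : ∀ A, 0 ≤ y A)
    (i : Fin D.k) {T : Finset α} (hT : Disjoint (D.core i) T) :
    wmass y (supersets (D.piece i) T) * #(supersets 𝒜 (D.core i))
      ≤ τ ^ #T * #(supersets 𝒜 (D.core i ∪ T)) * wmass y (D.piece i) :=
  (isRelHomogeneousW_supersets_iff hτ hy (subset_of_mem_of_subset_supersets (D.piece_subset i))).1
    (D.homogeneous i) T hT

section Links

variable {𝒜 ℱ : Finset (Finset α)} {S T : Finset α} {y : Finset α → ℝ}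

/-- **Mass of a link under the transported weight** `B ↦ y(S ∪ B)`: `Σ_{B ∈ ℱ(S)} y(S ∪ B) = y({A ∈ ℱ : S ⊆ A})`
(the relabelling `A ↦ A ∖ S` is a bijection from `{A ∈ ℱ : S ⊆ A}` onto the link, with inverse `B ↦ S ∪ B`).
[cite: KupavskiiZakharov2022, §2 (p. 6, definition of ℱ(S))] -/
theorem wmass_link (y : Finset α → ℝ) (ℱ : Finset (Finset α)) (S : Finset α) :
    wmass (fun B => y (S ∪ B)) (link ℱ S) = wmass y (supersets ℱ S) := by
  unfold wmass link
  rw [sum_image]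
  · refine sum_congr rfl fun A hA => ?_
    rw [union_sdiff_of_subset (mem_supersets.1 hA).2]
  · intro A hA A' hA' h
    have hSA : S ⊆ A := (mem_supersets.1 (mem_coe.1 hA)).2
    have hSA' : S ⊆ A' := (mem_supersets.1 (mem_coe.1 hA')).2
    have h' : A \ S = A' \ S := h
    rw [← union_sdiff_of_subset hSA, ← union_sdiff_of_subset hSA', h']

/-- **KZ Lemma 11 (ii) for weights, LINK FORM.** If every member of `ℱ` contains `S` and `y|_ℱ` is
`(𝒜(S), τ)`-homogeneous, then the transported weight `B ↦ y(S ∪ B)` on the link `ℱ(S)` is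
`(𝒜(S), τ)`-homogeneous as families on the ground set with `S` removed (`τ ≥ 0`, nonnegative weight;
test sets meeting `S` contribute `0 ≤ 0`). [cite: KupavskiiZakharov2022, Lemma 11 (ii)] -/
theorem IsRelHomogeneousW.link {τ : ℝ} (hτ : 0 ≤ τ) (hy : ∀ A, 0 ≤ y A) (hℱ : ∀ A ∈ ℱ, S ⊆ A)
    (h : IsRelHomogeneousW τ (supersets 𝒜 S) y ℱ) :
    IsRelHomogeneousW τ (link 𝒜 S) (fun B => y (S ∪ B)) (link ℱ S) := by
  intro T
  by_cases hT : Disjoint S T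
  · have key := h T
    rw [supersets_supersets] at key
    have hST : supersets ℱ (S ∪ T) = supersets ℱ T := by
      ext A
      simp only [mem_supersets, union_subset_iff]
      exact ⟨fun h' => ⟨h'.1, h'.2.2⟩, fun h' => ⟨h'.1, hℱ A h'.1, h'.2⟩⟩
    have h1 : wmass (fun B => y (S ∪ B)) (supersets (SetFamily.link ℱ S) T) = wmass y (supersets ℱ T) := by
      rw [supersets_link_of_disjoint hT, wmass_link,
        supersets_eq_self_of_forall (fun A hA => subset_union_left.trans (mem_supersets.1 hA).2), hST]
    have h2 : wmass (fun B => y (S ∪ B)) (SetFamily.link ℱ S) = wmass y ℱ := by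
      rw [wmass_link, supersets_eq_self_of_forall hℱ]
    rw [h1, h2, card_supersets_link_of_disjoint hT, card_link]
    exact key
  · rw [supersets_link_of_not_disjoint hT, wmass_empty, zero_mul]
    exact mul_nonneg (mul_nonneg (pow_nonneg hτ _) (Nat.cast_nonneg _))
      (wmass_nonneg (fun B => hy (S ∪ B)) _)

/-- The pieces of a weighted spread approximation in link form. [cite: KupavskiiZakharov2022, Lemma 11 (ii)] -/
theorem WeightedSpreadApproximation.link_homogeneous {τ : ℝ} {q : ℕ} (D : WeightedSpreadApproximation 𝒜 ℱ y τ q)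
    (hτ : 0 ≤ τ) (hy : ∀ A, 0 ≤ y A) (i : Fin D.k) :
    IsRelHomogeneousW τ (link 𝒜 (D.core i)) (fun B => y (D.core i ∪ B)) (link (D.piece i) (D.core i)) :=
  (D.homogeneous i).link hτ hy (subset_of_mem_of_subset_supersets (D.piece_subset i))

/-- `y`-mass of the piece's link under the transported weight equals the mass of the piece.
[cite: KupavskiiZakharov2022, Lemma 11 (ii)] -/
theorem WeightedSpreadApproximation.wmass_link_piece {τ : ℝ} {q : ℕ} (D : WeightedSpreadApproximation 𝒜 ℱ y τ q)
    (i : Fin D.k) : wmass (fun B => y (D.core i ∪ B)) (link (D.piece i) (D.core i)) = wmass y (D.piece i) := by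
  rw [wmass_link, supersets_eq_self_of_forall (subset_of_mem_of_subset_supersets (D.piece_subset i))]

end Links

/-! ### Relabelling the ground set (appended): transport of weighted homogeneity along an injection

A consumer that moves a reduced instance to a standard ground set (the `PneNP` matching programme maps the
perfect matchings of `K_n` minus the support of a core to those of `K_m`) defines the weight `y'` on the TARGET
and works on the source with its pull-back `A ↦ y'(g(A))`; homogeneity then transports verbatim (set version:
`IsRelHomogeneous.image_image`). -/

section Relabel

variable {β : Type*} [DecidableEq β] {𝒜 ℱ : Finset (Finset α)}

omit [DecidableEq α] in
/-- `Finset.image g` is injective on the subsets of a set on which `g` is injective. [folklore] -/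
private theorem image_injOn_of_subset' {g : α → β} {E : Finset α}
    (hg : Set.InjOn g E) {A A' : Finset α} (hA : A ⊆ E) (hA' : A' ⊆ E)
    (h : A.image g = A'.image g) : A = A' := by
  have key : ∀ {B B' : Finset α}, B ⊆ E → B' ⊆ E → B.image g = B'.image g → B ⊆ B' := by
    intro B B' hB hB' hBB' x hx
    have : g x ∈ B'.image g := hBB' ▸ mem_image_of_mem g hx
    obtain ⟨x', hx', hxx'⟩ := mem_image.1 this
    rwa [hg (hB hx) (hB' hx') hxx'.symm]
  exact Subset.antisymm (key hA hA' h) (key hA' hA h.symm)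

omit [DecidableEq α] in
/-- **Mass under relabelling**: for `g` injective on a set `E` containing every member of `P`, the mass of the
relabelled family under a weight `y'` on the target is the mass of `P` under the pulled-back weight
`A ↦ y'(g(A))`. [cite: KupavskiiZakharov2022, §2 (invariance under renaming the ground set)] -/
theorem wmass_image (y' : Finset β → ℝ) {g : α → β} {E : Finset α} (hg : Set.InjOn g E)
    {P : Finset (Finset α)} (hP : ∀ A ∈ P, A ⊆ E) :
    wmass y' (P.image (Finset.image g)) = wmass (fun A => y' (A.image g)) P := by
  unfold wmass
  rw [sum_image]
  exact fun A hA A' hA' h => image_injOn_of_subset' hg (hP A (mem_coe.1 hA)) (hP A' (mem_coe.1 hA')) h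

/-- **Weighted relative homogeneity is invariant under relabelling the ground set**: if `g` is injective on a
set `E` containing every member of `𝒜` and of `ℱ`, and the pulled-back weight `A ↦ y'(g(A))` carried by `ℱ`
is `(𝒜, τ)`-homogeneous, then `y'` carried by the relabelled family `{g(A) : A ∈ ℱ}` is
`({g(A) : A ∈ 𝒜}, τ)`-homogeneous (`τ ≥ 0`, `y' ≥ 0`; a test set not inside `g(E)` is contained in no
relabelled member). [cite: KupavskiiZakharov2022, §2 (definition of (𝒜, τ)-homogeneous; invariant under renaming the ground set)] -/
theorem IsRelHomogeneousW.image_image {τ : ℝ} (hτ : 0 ≤ τ) {E : Finset α} {g : α → β}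
    (hg : Set.InjOn g E) (h𝒜 : ∀ A ∈ 𝒜, A ⊆ E) (hℱ : ∀ A ∈ ℱ, A ⊆ E) {y' : Finset β → ℝ}
    (hy' : ∀ B, 0 ≤ y' B) (h : IsRelHomogeneousW τ 𝒜 (fun A => y' (A.image g)) ℱ) :
    IsRelHomogeneousW τ (𝒜.image (Finset.image g)) y' (ℱ.image (Finset.image g)) := by
  intro T
  have hcard : ∀ 𝒳 : Finset (Finset α), (∀ A ∈ 𝒳, A ⊆ E) → #(𝒳.image (Finset.image g)) = #𝒳 :=
    fun 𝒳 h𝒳 => card_image_of_injOn fun A hA A' hA' hAA' =>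
      image_injOn_of_subset' hg (h𝒳 A (mem_coe.1 hA)) (h𝒳 A' (mem_coe.1 hA')) hAA'
  by_cases hT : T ⊆ E.image g
  · -- `T = g(T₀)` with `T₀ ⊆ E`
    set T₀ : Finset α := E.filter (fun x => g x ∈ T) with hT₀
    have hT₀E : T₀ ⊆ E := filter_subset _ _
    have hTT₀ : T₀.image g = T := by
      ext y
      simp only [hT₀, mem_image, mem_filter]
      constructor
      · rintro ⟨x, ⟨-, hx⟩, rfl⟩; exact hx
      · intro hy
        obtain ⟨x, hxE, rfl⟩ := mem_image.1 (hT hy)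
        exact ⟨x, ⟨hxE, hy⟩, rfl⟩
    have hcardT : #T = #T₀ := by rw [← hTT₀, card_image_of_injOn (hg.mono (coe_subset.2 hT₀E))]
    have hsup : ∀ 𝒳 : Finset (Finset α), (∀ A ∈ 𝒳, A ⊆ E) →
        supersets (𝒳.image (Finset.image g)) T = (supersets 𝒳 T₀).image (Finset.image g) := by
      intro 𝒳 h𝒳
      ext B
      simp only [mem_supersets, mem_image]
      constructor
      · rintro ⟨⟨A, hA, rfl⟩, hTB⟩
        refine ⟨A, ⟨hA, fun x hx => ?_⟩, rfl⟩
        obtain ⟨hxE, hgx⟩ := mem_filter.1 hx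
        obtain ⟨a, ha, hga⟩ := mem_image.1 (hTB hgx)
        rwa [hg hxE (h𝒳 A hA ha) hga.symm]
      · rintro ⟨A, ⟨hA, hT₀A⟩, rfl⟩
        exact ⟨⟨A, hA, rfl⟩, by rw [← hTT₀]; exact image_subset_image hT₀A⟩
    have hℱT : ∀ A ∈ supersets ℱ T₀, A ⊆ E := fun A hA => hℱ A (supersets_subset _ _ hA)
    rw [hsup ℱ hℱ, hsup 𝒜 h𝒜, wmass_image y' hg hℱT, wmass_image y' hg hℱ,
      hcard _ (fun A hA => h𝒜 A (supersets_subset _ _ hA)), hcard 𝒜 h𝒜, hcardT]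
    exact h T₀
  · have hempty : supersets (ℱ.image (Finset.image g)) T = ∅ := by
      refine filter_eq_empty_iff.2 fun B hB hTB => hT ?_
      obtain ⟨A, hA, rfl⟩ := mem_image.1 hB
      exact hTB.trans (image_subset_image (hℱ A hA))
    rw [hempty, wmass_empty, zero_mul]
    exact mul_nonneg (mul_nonneg (pow_nonneg hτ _) (Nat.cast_nonneg _)) (wmass_nonneg hy' _)

end Relabel

end Literature.Combinatorics.SetFamily
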